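import Summits.Ventures.Crystal3D.Kissing125.GSearchNumerics
import HarnessLib

/-!
# Cells and slot enclosures of the growth search, κ-generic

HONEST FRAMING (cell pub-crystal3d, K-path at `h = 5/4`, V4 = κ as an explicit parameter): this is NOT a result printed
by Hales; it is his METHOD (arXiv:1209.6043, Theorem 3 + Lemmas 7–10, in the tree's form of a verified interval-arithmetic
growth search, `Literature/…/KissingSearch*.lean`) with the largest long-side cosine `κ` made an EXPLICIT PARAMETER
(`κ : Kappa`, carrying the two numeric facts the soundness proof uses: `-1/2 ≤ κ`, `κ < 1/4`).  Only the declarations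
whose statement depends on `κ` are declared here (namespace `…Kissing125.GSearch`, the tree's short names, no renames);
every κ-free helper is the landed K25 copy (`…Kissing125.KissingSearch.*`) and every κ-free lemma is cited from the tree
(PRIVATE per-file citation aliases; `GSearchTransport.lean` holds `toT : St → tree St` and the transport equalities).  The K25
instance is `κ25 = ⟨7/32, …⟩`; `GSearchBridge.lean` identifies the generic checker at
`κ25` with the landed `Kissing125.KissingSearch.checkPart`, so the landed run files are consumed unchanged.  Generated by
`HOME/lean/kissing125/v4-prep/gen/mkgen.py`; nothing here is asserted about GAP(1.26) or any census.

THIS FILE: the κ-tainted declarations of `Literature/Geometry/DiscreteGeometry/KissingSearchStructure.lean` (part 1 of 1), with `κ : Kappa` threaded; κ-free declarations of that file are NOT re-declared publicly (the κ-free helpers are the landed K25 copies; the κ-free tree lemmas used by the proofs are cited through PRIVATE aliases at the top of the file).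

## References
* T. C. Hales, *A proof of Fejes Tóth's conjecture on sphere packings with kissing number twelve*,
  arXiv:1209.6043 (2012): Definition 1, Theorem 2, Theorem 3, Lemmas 7–10. [`Hales2012`]
* R. E. Moore, *Interval Analysis* (1966), Theorem 3.1, §4.4. [`Moore1966`]
-/

namespace Summit.Ventures.Crystal3D.Kissing125

open Literature.Geometry.DiscreteGeometry
open Summit.Ventures.Crystal3D.Kissing125.KissingSearch

namespace GSearch

open Real Literature.Analysis.ValidatedNumerics KissingLP NonemptyInterval Finset

variable {κ : Kappa}

/-! ### κ-free tree lemmas used below, read over the K25 copies (PRIVATE citation aliases; the public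
surface of this file is κ-generic only) -/

/-- K25 reading of the tree lemma `le_K_of_mem_symsList` (κ-free; proof = citation of the tree lemma). [folklore] -/
private theorem le_K_of_mem_symsList {r σ : ℕ} (hr : ValidDom r)
  (hσ : σ ∈ symsList r) : σ ≤ K :=
  Literature.Geometry.DiscreteGeometry.KissingSearch.le_K_of_mem_symsList hr hσ

/-- K25 reading of the tree lemma `lt_NS_of_mem_symsList` (κ-free; proof = citation of the tree lemma). [folklore] -/
private theorem lt_NS_of_mem_symsList {r σ : ℕ} (hr : ValidDom r)
  (hσ : σ ∈ symsList r) : σ < NS :=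
  Literature.Geometry.DiscreteGeometry.KissingSearch.lt_NS_of_mem_symsList hr hσ

/-- K25 reading of the tree lemma `lt_of_mem_tset` (κ-free; proof = citation of the tree lemma). [folklore] -/
private theorem lt_of_mem_tset {t v : ℕ} (ht : TriValid t) (hv : v ∈ tset t) : v < 12 :=
  Literature.Geometry.DiscreteGeometry.KissingSearch.lt_of_mem_tset ht hv

/-- K25 reading of the tree lemma `others_spec` (κ-free; proof = citation of the tree lemma). [folklore] -/
private theorem others_spec {t v : ℕ} (ht : TriValid t) (hv : v ∈ tset t) :
  v ≠ (others t v).1 ∧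
    v ≠ (others t v).2 ∧ (others t v).1 ≠ (others t v).2 ∧ tset t = {v, (others t v).1, (others t v).2} :=
  Literature.Geometry.DiscreteGeometry.KissingSearch.others_spec ht hv


/-! ### Part B. Triangle codes, side indices, accessors -/

section Accessors

variable {s : St}

end Accessors

/-! ### Part C. Domain semantics, cells, realized states -/

/-- `gridPt` is monotone. [folklore] -/
theorem gridPt_mono {i j : ℕ} (h : i ≤ j) : gridPt κ i ≤ gridPt κ j := by
  unfold gridPt
  have hc : (0 : ℚ) ≤ (κ.val + 1 / 2) / K := by
    have h0 : (0 : ℚ) ≤ κ.val + 1 / 2 := by linarith [κ.neg_half_le]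
    exact div_nonneg h0 (by positivity)
  have : (κ.val + 1 / 2) * (i : ℚ) / K ≤ (κ.val + 1 / 2) * (j : ℚ) / K := by
    rw [mul_div_right_comm, mul_div_right_comm]
    exact mul_le_mul_of_nonneg_left (by exact_mod_cast h) hc
  linarith

/-- Membership in a cell `σ ≥ 1` is membership in `[gridPt (σ-1), gridPt σ]`. [folklore] -/
theorem symMem_cell_iff {σ : ℕ} (hσ : σ ≠ 0) {x : ℝ} :
    SymMem κ σ x ↔ ((gridPt κ (σ - 1) : ℚ) : ℝ) ≤ x ∧ x ≤ ((gridPt κ σ : ℚ) : ℝ) := by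
  unfold SymMem symIv mkIv
  rw [if_neg hσ, mem_ratCast_iff]
  simp only
  rw [min_eq_left (gridPt_mono (Nat.sub_le σ 1)), max_eq_right (gridPt_mono (Nat.sub_le σ 1))]

/-- The contact symbol's cell is `{1/2}`. [folklore] -/
theorem symMem_zero_iff {x : ℝ} : SymMem κ 0 x ↔ x = 1 / 2 := by
  unfold SymMem symIv mkIv
  simp only [↓reduceIte, mem_ratCast_iff, min_self, max_self]
  push_cast
  constructor
  · intro h; linarith [h.1, h.2]
  · intro h; rw [h]; exact ⟨le_rfl, le_rfl⟩

/-- **Locating the cell**: a real in `[gridPt (lo-1), gridPt hi]` with `1 ≤ lo ≤ hi` lies in the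
cell of some `σ ∈ [lo, hi]`. [folklore] -/
theorem exists_cell : ∀ (n lo hi : ℕ) {x : ℝ}, hi = lo + n → 1 ≤ lo →
    ((gridPt κ (lo - 1) : ℚ) : ℝ) ≤ x → x ≤ ((gridPt κ hi : ℚ) : ℝ) →
    ∃ σ, lo ≤ σ ∧ σ ≤ hi ∧ SymMem κ σ x
  | 0, lo, hi, x, hn, h1, hlo, hhi => by
    refine ⟨lo, le_rfl, by omega, ?_⟩
    rw [symMem_cell_iff (by omega)]
    exact ⟨hlo, by rw [hn, Nat.add_zero] at hhi; exact hhi⟩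
  | n + 1, lo, hi, x, hn, h1, hlo, hhi => by
    by_cases hx : x ≤ ((gridPt κ lo : ℚ) : ℝ)
    · exact ⟨lo, le_rfl, by omega, (symMem_cell_iff (by omega)).2 ⟨hlo, hx⟩⟩
    · obtain ⟨σ, h1', h2', h3'⟩ := exists_cell n (lo + 1) hi (by omega) (by omega)
        (by rw [Nat.add_sub_cancel]; exact (not_le.1 hx).le) hhi
      exact ⟨σ, by omega, h2', h3'⟩

/-- **From a domain code to a symbol**: a labelled side's Gram entry lies in the cell of a symbol
of its domain. [folklore] -/
theorem exists_symMem_of_domSem {r : ℕ} {x : ℝ} (h : DomSem κ r x) (hr : r ≠ UNL) :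
    ValidDom r ∧ ∃ σ ∈ symsList r, SymMem κ σ x := by
  rcases h with h | ⟨rfl, hx⟩ | ⟨hv, hr0, -, hlo, hhi⟩
  · exact absurd h hr
  · refine ⟨Or.inl rfl, 0, ?_, symMem_zero_iff.2 hx⟩
    unfold symsList; simp
  · refine ⟨hv, ?_⟩
    rcases hv with rfl | ⟨h1, h2, h3, -⟩
    · exact absurd rfl hr0
    · obtain ⟨σ, hs1, hs2, hs3⟩ := exists_cell (rHi r - rLo r) (rLo r) (rHi r) (by omega) h1 hlo hhi
      refine ⟨σ, ?_, hs3⟩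
      unfold symsList
      rw [if_neg hr0, List.mem_range'_1]
      omega

/-! ### Part D. Brackets of placed slots enclose the true angles -/

/-- `κ₀ < 1/2`. [folklore] -/
theorem κ0R_lt_half : κR κ < 1 / 2 := by
  have h : ((κ.val : ℚ) : ℝ) < ((1 / 4 : ℚ) : ℝ) := Rat.cast_lt.mpr κ.lt_quarter
  push_cast at h
  unfold κR; linarith

/-- **The slot bracket encloses the angle.**  In a realized state, for a placed triangle `t` and
a vertex `v` of it, `Encl (s.slotBr t v) (M.ang (tset t) v)`. [cite: Moore1966, Theorem 3.1] -/
theorem slot_encl {M : KConf κ} {s : St} (hR : Realizes M s) {t : ℕ} (ht : t ∈ s.tris.toList)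
    {v : ℕ} (hv : v ∈ tset t) : Encl (St.slotBr κ s t v) (M.ang (tset t) v) := by
  have hval := hR.valid t ht
  obtain ⟨hva, hvb, hab, hset⟩ := others_spec hval hv
  set a := (others t v).1 with ha_def
  set b := (others t v).2 with hb_def
  have hT : tset t ∈ M.T := hR.mem t ht
  have hv12 : v < 12 := lt_of_mem_tset hval hv
  have haT : a ∈ tset t := by rw [hset]; simp
  have hbT : b ∈ tset t := by rw [hset]; simp
  have ha12 : a < 12 := lt_of_mem_tset hval haT
  have hb12 : b < 12 := lt_of_mem_tset hval hbT
  -- the three sides are labelled, with valid domains enclosing the Gram entries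
  have lva := hR.side_lab t ht v hv a haT hva
  have lvb := hR.side_lab t ht v hv b hbT hvb
  have lab := hR.side_lab t ht a haT b hbT hab
  obtain ⟨vda, σa, hσa, hxa⟩ := exists_symMem_of_domSem (hR.dom v a hv12 ha12 hva) lva
  obtain ⟨vdb, σb, hσb, hxb⟩ := exists_symMem_of_domSem (hR.dom v b hv12 hb12 hvb) lvb
  obtain ⟨vdc, σc, hσc, hxc⟩ := exists_symMem_of_domSem (hR.dom a b ha12 hb12 hab) lab
  -- the basic bracket of the true cells encloses the angle
  have hcos := M.cos_law _ hT v hv a haT b hbT hva hvb hab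
  have hP := M.circum _ hT v hv a haT b hbT hva hvb hab
  have hx1 := sq_lt_one_of_symMem (le_K_of_mem_symsList vda hσa) hxa
  have hy1 := sq_lt_one_of_symMem (le_K_of_mem_symsList vdb hσb) hxb
  have hbasic := basic_sound hxa hxb hxc hx1 hy1 hP (M.ang_nonneg _ _) (M.ang_le_pi _ _) hcos
  rw [← btab_eq (lt_NS_of_mem_symsList vda hσa) (lt_NS_of_mem_symsList vdb hσb)
    (lt_NS_of_mem_symsList vdc hσc)] at hbasic
  have hC := rangeC_sound hσc hbasic
  have hBr := rangeBr_sound vda vdb vdc hσa hσb hC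
  unfold St.slotBr
  exact hBr


end GSearch

end Summit.Ventures.Crystal3D.Kissing125
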